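import Summits.Ventures.HodgeRepro2.T5SmithFractionField
import Summits.Ventures.HodgeRepro2.T5LocalFieldUnitsDecomposition

/-!
# The Cartan decomposition normalised by a uniformiser: `GL_n(F) = ⋃_a K · diag(ϖ^a) · K`

Tier-5 kernel support (blind cell pub-hodge-repro2, seat p8, gen 11). `T5SmithFractionField`
gives `g = k₁ · diag(a) · k₂` with `a ∈ (F^×)^n` for any PID `R`; over a discrete valuation ring
every `a_i` is a unit of `R` times an integer power of the uniformiser `ϖ` (p4's
`T5LocalFieldUnitsDecomposition.exists_unit_mul_zpow`, imported, not re-proved), and the unit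
part is absorbed into `k₁`. This is the decomposition in the printed form of the record,
`GL_n(F_v) = ⋃_{a ∈ ℤ^n} GL_n(𝒪_v) · diag(ϖ^{a_1}, …, ϖ^{a_n}) · GL_n(𝒪_v)`
(the exponents are not sorted here; the double coset does not depend on their order).

* `diagonalUnit u : GL ι R` — the diagonal matrix of a family of units;
* `exists_cartan_uniformiser` — **`g = k₁ · diag(ϖ^{m_i}) · k₂`** with `k₁, k₂ ∈ GL_n(R)`.

Hypotheses as stated in the kernel: `R` a commutative domain with `[IsDiscreteValuationRing R]`,
`ϖ : R` irreducible (a uniformiser), `F` a field with `[Algebra R F] [IsFractionRing R F]`, `ι` a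
finite type with decidable equality.
-/

namespace Summit.Ventures.HodgeRepro2.T5CartanUniformiser

open Matrix

variable {R : Type*} [CommRing R] {ι : Type*} [Fintype ι] [DecidableEq ι]

/-- The diagonal matrix of a family of units of `R`, as an element of `GL ι R`. -/
def diagonalUnit (u : ι → Rˣ) : GL ι R :=
  ⟨diagonal fun i => (u i : R), diagonal fun i => ((u i)⁻¹ : Rˣ),
    by simp [diagonal_mul_diagonal], by simp [diagonal_mul_diagonal]⟩

/-- The matrix underlying `diagonalUnit u`. -/
@[simp] theorem coe_diagonalUnit (u : ι → Rˣ) :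
    (diagonalUnit u : Matrix ι ι R) = diagonal fun i => (u i : R) := rfl

variable [IsDomain R] [IsDiscreteValuationRing R]
variable {F : Type*} [Field F] [Algebra R F] [IsFractionRing R F]

/-- **The Cartan decomposition with a uniformiser**: every `g ∈ GL ι F` is
`k₁ · diag(ϖ^{m_1}, …) · k₂` with `k₁, k₂ ∈ GL_n(R)` and `m : ι → ℤ`. -/
theorem exists_cartan_uniformiser {ϖ : R} (hϖ : Irreducible ϖ) (g : GL ι F) :
    ∃ k₁ ∈ (Matrix.GeneralLinearGroup.map (n := ι) (algebraMap R F)).range,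
      ∃ k₂ ∈ (Matrix.GeneralLinearGroup.map (n := ι) (algebraMap R F)).range,
        ∃ m : ι → ℤ, (g : Matrix ι ι F) =
          (k₁ : Matrix ι ι F) * diagonal (fun i => algebraMap R F ϖ ^ m i) * (k₂ : Matrix ι ι F) := by
  obtain ⟨k₁, hk₁, k₂, hk₂, a, ha, hg⟩ :=
    T5SmithFractionField.exists_cartan_diagonal_units (R := R) g
  choose u m hum using fun i =>
    T5LocalFieldUnitsDecomposition.exists_unit_mul_zpow ϖ hϖ (a i) (ha i)
  have hdiag : diagonal a =
      diagonal (fun i => algebraMap R F (u i)) * diagonal (fun i => algebraMap R F ϖ ^ m i) := by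
    rw [diagonal_mul_diagonal]
    congr 1
    funext i
    exact hum i
  refine ⟨k₁ * Matrix.GeneralLinearGroup.map (algebraMap R F) (diagonalUnit u),
    Subgroup.mul_mem _ hk₁ ⟨_, rfl⟩, k₂, hk₂, m, ?_⟩
  rw [hg, hdiag, Units.val_mul, T5SmithFractionField.coe_map_eq_map, coe_diagonalUnit,
    Matrix.diagonal_map (map_zero _)]
  simp only [mul_assoc]

end Summit.Ventures.HodgeRepro2.T5CartanUniformiser
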